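import Literature.NumberTheory.GaloisRepresentations.BrauerHassePrinciple
import Literature.NumberTheory.GaloisCohomology.PoitouTateSha
import HarnessLib

/-!
# `Ш²(K, 𝔾_m) = 0`: a class of `H²(K, K̄ˣ)` which is locally trivial at every place vanishes (Brauer–Hasse–Noether, class form)

Topic `NumberTheory/GaloisCohomology`; namespace `Literature.NumberTheory.GaloisCohomology`.  Theorems only; no
definition, no named fact, no instance, no `sorry`.

The tree proves the Hasse principle for `H²(K, K̄ˣ)` in EXPLICIT-COCYCLE form
(`Literature.NumberTheory.GaloisRepresentations.twoCocycle_cob_of_locallyTrivial`, Cassels–Fröhlich VII §9.6/§10: a locally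
constant `2`-cocycle `Γ_K × Γ_K → K̄ˣ` which is a coboundary over every completion is a coboundary).  This file restates it on
the tree's cohomology CLASSES: for a number field `K` and the discrete Galois module `units K` (`K̄ˣ`, written additively),

* **`eq_zero_of_forall_localization_units_two_eq_zero`** — `x ∈ H²(K, K̄ˣ)` with `loc_v x = 0` in `H²(K_v, K̄ˣ)` at every place
  `v` (finite and infinite; `galoisCohomology.localization`) is `0`;
* **`shaTwo_units_eq_bot`** — `Ш²(K, K̄ˣ) = 0` (`DiscreteGaloisModule.shaTwo (units K) = ⊥`): the injectivity of
  `Br(K) → ⊕_v Br(K_v)` (Albert–Brauer–Hasse–Noether).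

Proof: represent `x` by a continuous inhomogeneous `2`-cocycle (`twoCocycleClass_surjective`), pass to the multiplicative
cocycle `e = toMul ∘ f`, read each hypothesis `loc_v x = 0` as a coboundary over `Γ_{K_v}` (`map_twoCocycleClass`,
`twoCocycleClass_eq_zero_iff`) pushed into `K̄_vˣ` along the chosen embedding (`absGaloisRestrict_apply_smul`), apply
`twoCocycle_cob_of_locallyTrivial`, and read the global coboundary back.

USE: input (A) of the `Ш²`-exhaustion of the native obstruction map on the Poitou–Tate road (cell `bsd-wall`, seat
`bsd-line-chl-p2`; `HomDual.localGlobal_of_forall_evalPoint`): the restricted classes `ev_m(res_{K(M)} c)` live in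
`H²(K(M), \overline{K(M)}ˣ)` and are locally trivial.  HONEST FRAMING: classical; no case of Poitou–Tate or BSD is proved here.

## References
* J. W. S. Cassels, A. Fröhlich (eds.), *Algebraic Number Theory* (1967), Ch. VII (Tate) §9.6, §10, §11.2 (b).
  [CasselsFrohlichANT1967]
* D. Harari, *Galois Cohomology and Class Field Theory* (2020), Thm. 14.11. [Harari2020]
* J. Neukirch, A. Schmidt, K. Wingberg, *Cohomology of Number Fields* (2008), (8.1.17). [NeukirchSchmidtWingberg2008]
-/

noncomputable section

open CategoryTheory NumberField IsDedekindDomain Field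

universe u

namespace Literature.NumberTheory.GaloisCohomology

open Literature.NumberTheory.GaloisRepresentations
open Literature.NumberTheory.GaloisRepresentations.DiscreteGaloisModule (units UnitsCarrier shaTwo mem_shaTwo_iff)

variable {K : Type u} [Field K] [NumberField K]

/-- The multiplicative reading `K̄ˣ` of an element of the additive carrier `UnitsCarrier K = Additive K̄ˣ`. [folklore] -/
private def toUnit (u : UnitsCarrier K) : (AlgebraicClosure K)ˣ := (UnitsCarrier.toAdditive u).toMul

omit [NumberField K] in
/-- `toUnit` is additive-to-multiplicative. [folklore] -/
private theorem toUnit_add (u u' : UnitsCarrier K) : toUnit (u + u') = toUnit u * toUnit u' := by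
  simp only [toUnit, map_add, toMul_add]

omit [NumberField K] in
/-- `toUnit` turns subtraction into division. [folklore] -/
private theorem toUnit_sub (u u' : UnitsCarrier K) : toUnit (u - u') = toUnit u / toUnit u' := by
  simp only [toUnit, map_sub, toMul_sub]

omit [NumberField K] in
/-- `toUnit` intertwines the module action with the Galois action on `K̄ˣ`. [folklore] -/
private theorem toUnit_units (σ : absoluteGaloisGroup K) (u : UnitsCarrier K) : toUnit (units K σ u) = σ • toUnit u := by
  simp only [toUnit, DiscreteGaloisModule.units_apply_apply, toMul_ofMul]

omit [NumberField K] in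
/-- `toUnit` is injective. [folklore] -/
private theorem toUnit_injective : Function.Injective (toUnit (K := K)) := fun _ _ h =>
  UnitsCarrier.toAdditive.injective (Additive.toMul.injective h)

/-- A local coboundary for the localisation of a `K̄ˣ`-valued `2`-cocycle along `Γ_L → Γ_K`, read multiplicatively in `L̄ˣ`
through the chosen embedding `K̄ → L̄`. [cite: SerreGaloisCohomology1997, I §2.3, §2.4] -/
private theorem exists_cob_of_map_twoCocycleClass_eq_zero (L : Type u) [Field L] [Algebra K L]
    (f : contTwoCocycles (units K).toTopRep)
    (h : galoisCohomology.res (units K) L 2 (twoCocycleClass _ f) = 0) :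
    ∃ b : absoluteGaloisGroup L → (AlgebraicClosure L)ˣ, IsLocallyConstant b ∧ ∀ x y,
      Units.map (absClosureEmbedding K L : AlgebraicClosure K →* AlgebraicClosure L)
          (toUnit (f.1 (absGaloisRestrict K L x, absGaloisRestrict K L y))) =
        b x * x • b y / b (x * y) := by
  haveI := absoluteGaloisGroup_compactSpace K
  haveI := absoluteGaloisGroup_compactSpace L
  have e4 : galoisCohomology.res (units K) L 2 (twoCocycleClass _ f) =
      twoCocycleClass (DiscreteGaloisModule.toTopRep ((units K).restrictField L))
        (contTwoCocycles.pullback (absGaloisRestrict K L) (X := (units K).toTopRep)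
          (Y := DiscreteGaloisModule.toTopRep ((units K).restrictField L))
          (TopRep.ofHom ⟨ContinuousLinearMap.id ℤ (UnitsCarrier K), fun _ => rfl⟩) f) :=
    map_twoCocycleClass (absGaloisRestrict K L) (X := (units K).toTopRep)
      (Y := DiscreteGaloisModule.toTopRep ((units K).restrictField L))
      (TopRep.ofHom ⟨ContinuousLinearMap.id ℤ (UnitsCarrier K), fun _ => rfl⟩) _
  rw [e4] at h
  obtain ⟨b, hb⟩ := (twoCocycleClass_eq_zero_iff _ _).1 h
  refine ⟨fun x => Units.map (absClosureEmbedding K L : AlgebraicClosure K →* AlgebraicClosure L) (toUnit (b x)),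
    ((IsLocallyConstant.iff_continuous _).2 b.continuous).comp _, fun x y => ?_⟩
  have hxy : f.1 (absGaloisRestrict K L x, absGaloisRestrict K L y) =
      units K (absGaloisRestrict K L x) (b y) - b (x * y) + b x := hb x y
  rw [hxy, toUnit_add, toUnit_sub, toUnit_units, map_mul, map_div]
  have hsm : Units.map (absClosureEmbedding K L : AlgebraicClosure K →* AlgebraicClosure L)
      (absGaloisRestrict K L x • toUnit (b y)) =
      x • Units.map (absClosureEmbedding K L : AlgebraicClosure K →* AlgebraicClosure L) (toUnit (b y)) :=
    Units.ext (by
      rw [Units.coe_map, Units.coe_smul, Units.coe_smul, Units.coe_map, MonoidHom.coe_coe]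
      exact absGaloisRestrict_apply_smul K L x _)
  rw [hsm]
  beta_reduce
  rw [div_mul_eq_mul_div, mul_comm (x • _)]

/-- **Brauer–Hasse–Noether on classes: a class of `H²(K, K̄ˣ)` which is locally trivial at every place is zero**
(`x ∈ H²(K, K̄ˣ)`, `loc_v x = 0` in `H²(K_v, K̄ˣ)` for every place `v` of the number field `K` ⟹ `x = 0`; the injectivity of
`Br(K) → ⊕_v Br(K_v)`, from the tree's cocycle-form theorem `twoCocycle_cob_of_locallyTrivial`).
[cite: CasselsFrohlichANT1967, Ch. VII §9.6, §10, §11.2 (b)][cite: Harari2020, Thm. 14.11] -/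
theorem eq_zero_of_forall_localization_units_two_eq_zero (x : galoisCohomology (units K) 2)
    (hx : ∀ v : Place K, galoisCohomology.localization (units K) v 2 x = 0) : x = 0 := by
  haveI := absoluteGaloisGroup_compactSpace K
  obtain ⟨f, rfl⟩ := twoCocycleClass_surjective _ x
  -- the multiplicative cocycle
  let e : absoluteGaloisGroup K → absoluteGaloisGroup K → (AlgebraicClosure K)ˣ := fun σ τ => toUnit (f.1 (σ, τ))
  have hlc : IsLocallyConstant fun p : absoluteGaloisGroup K × absoluteGaloisGroup K => e p.1 p.2 :=
    ((IsLocallyConstant.iff_continuous _).2 f.1.continuous).comp _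
  have hcoc : ∀ σ τ υ, e σ τ * e (σ * τ) υ = σ • e τ υ * e σ (τ * υ) := fun σ τ υ => by
    have h := congrArg (toUnit (K := K)) (f.2 σ τ υ)
    change toUnit (units K σ (f.1 (τ, υ)) + f.1 (σ, τ * υ)) = toUnit (f.1 (σ * τ, υ) + f.1 (σ, τ)) at h
    rw [toUnit_add, toUnit_add, toUnit_units] at h
    change toUnit (f.1 (σ, τ)) * toUnit (f.1 (σ * τ, υ)) = σ • toUnit (f.1 (τ, υ)) * toUnit (f.1 (σ, τ * υ))
    rw [mul_comm, ← h]
  -- local triviality, finite and infinite places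
  have hfin := fun v : HeightOneSpectrum (𝓞 K) =>
    exists_cob_of_map_twoCocycleClass_eq_zero (K := K) (L := Place.Completion (Sum.inr v : Place K)) f (hx (Sum.inr v))
  have hinf := fun w : InfinitePlace K =>
    exists_cob_of_map_twoCocycleClass_eq_zero (K := K) (L := Place.Completion (Sum.inl w : Place K)) f (hx (Sum.inl w))
  -- the Hasse principle
  obtain ⟨b, hb, hbe⟩ := twoCocycle_cob_of_locallyTrivial e hlc hcoc hfin hinf
  refine (twoCocycleClass_eq_zero_iff _ _).2
    ⟨⟨fun σ => UnitsCarrier.toAdditive.symm (Additive.ofMul (b σ)), ?_⟩, fun σ τ => ?_⟩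
  · exact (hb.comp _).continuous
  · apply toUnit_injective
    change e σ τ = toUnit (units K σ (UnitsCarrier.toAdditive.symm (Additive.ofMul (b τ))) -
      UnitsCarrier.toAdditive.symm (Additive.ofMul (b (σ * τ))) + UnitsCarrier.toAdditive.symm (Additive.ofMul (b σ)))
    rw [toUnit_add, toUnit_sub, toUnit_units, hbe σ τ]
    change _ = σ • b τ / b (σ * τ) * b σ
    rw [mul_comm (b σ), div_mul_eq_mul_div]

/-- **`Ш²(K, 𝔾_m) = 0`**: the second Tate–Shafarevich group of `K̄ˣ` over a number field vanishes
(`DiscreteGaloisModule.shaTwo (units K) = ⊥`; Albert–Brauer–Hasse–Noether, injectivity of `Br(K) → ⊕_v Br(K_v)`).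
[cite: CasselsFrohlichANT1967, Ch. VII §9.6, §10, §11.2 (b)][cite: Harari2020, Thm. 14.11][cite: NeukirchSchmidtWingberg2008, (8.1.17)] -/
theorem shaTwo_units_eq_bot (K : Type u) [Field K] [NumberField K] : shaTwo (units K) = ⊥ := by
  rw [eq_bot_iff]
  intro x hx
  rw [AddSubgroup.mem_bot]
  exact eq_zero_of_forall_localization_units_two_eq_zero x ((mem_shaTwo_iff _ x).1 hx)

end Literature.NumberTheory.GaloisCohomology

end
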